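import Summits.BirchSwinnertonDyer.Rank1Residual.Additive.LocalModelTransportTower
import Summits.BirchSwinnertonDyer.Rank1Residual.Additive.SignedTwistMinusLineShape
import HarnessLib

/-!
# Model transport in local Galois cohomology, V: the pulled-back minus line satisfies the tower
# condition (file 100's hypothesis `hCT`; cell `b2b-bsdres`, CLASS-CLOSURE lane, class O10 — x1b
# GEN 41, class lead; file 105 of the series)

HONEST FRAMING (cell `b2b-bsdres`, run/shared/lean/b2b/bsd-rank1-residual/, verbatim in every
file): the goal of the cell is to DELETE the COMBINATION-SHAPED residual classes of the
Birch–Swinnerton-Dyer formula for ALL analytic-rank `≤ 1` elliptic curves over `ℚ` — "full BSD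
formula for every rank `≤ 1` curve in class `C`" assembled STRICTLY from published theorems — so
that the rank-`≤ 1` remainder becomes exactly the CONSTRUCTION-SHAPED classes, which are TYPED
(missing-input `Prop`s), NOT attempted. This is not "finishing BSD". CLASS-CLOSURE lane: prove
what is provable now; shrink each hard class to its core with data; no claim beyond stated classes;
research routes on CONSTRUCTION-SHAPED X12 / O10; census / instrument output = EVIDENCE / conjecture
items, NEVER a Literature fact; `RESIDUAL-MAP.md` marks change only by signed lines. THIS FILE:
TOOL THEOREMS ONLY — no definition, no named Literature fact, no `sorry`, axioms standard; nothing
is booked; no label / mark / count / sub-cell moves; (C1_η), (C2_η-GZ), (C3_η) stay typed as filed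
(cc-typer-6's pen); nothing about `BSD(W, p)` of any pair is claimed.

## What (files 101–104 continued; `Σ_E = closure{minus classes at E}` as in files 94–98)

* `exists_kummerOn_ker_of_mem_closure_minus` (any `K`-field `E`): a class of `Σ_E` is represented
  by a cocycle that is **Kummer on `H_{E,∞}`** (file 94 `minus_of_mem_closure`: it is Kummer on the
  layer subgroup `H_{E,n}`, and `H_{E,∞} ≤ H_{E,n}`).
* **`comp_map_mem_localTowerKer_of_mem_comap`**: along a `K`-algebra map `E' → E` with
  `r : Γ_E → Γ_{E'}` onto, `E/E'` algebraic and a transport `Θ` (file 101, cocycle description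
  `[σ ↦ τ ψ(r σ)]`), **every class of the pulled-back line `Θ⁻¹(Σ_E)` satisfies the count's tower
  condition at `E'`** at every layer `k` — file 103 (`kummerOn_ker_of_transport`,
  `comp_map_oneCocycleClass_mem_localTowerKer_iff`). With `E = ℚ_[p]`, `E' = ℚ_{v₀}` and `k = 0`
  this is the hypothesis `hCT : C ≤ 𝓣(v₀)` of file 100 for `C = Θ⁻¹(Σ_p)` (via `h𝓣fin`).

References: [Kobayashi2003] Def. 2.1 (p. 5); [GreenbergLNM1716] §3 p. 86;
[SerreGaloisCohomology1997] I §2.4–2.5, II §1.1.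
-/

noncomputable section

open scoped Classical

open Field CategoryTheory WeierstrassCurve

namespace Summit.BirchSwinnertonDyer.Rank1Residual.Additive.LocalModelTransport

open Literature.NumberTheory.GaloisRepresentations Literature.NumberTheory.EllipticCurves
  Literature.NumberTheory.EllipticCurves.Kobayashi2003
open scoped ContRepresentation

variable {K : Type} [Field K] (W : WeierstrassCurve K) {p : ℕ} [Fact p.Prime] (κ : ZpExtension K p)

/-- **A class of the minus line `Σ_E` is Kummer on `H_{E,∞}`**: every element of
`closure{minus classes}` is a minus class (file 94), i.e. represented by a cocycle `φ` with
`ι_E(φ u) = u R − R` on the layer subgroup `H_{E,n} ⊇ H_{E,∞}`. [cite: Kobayashi2003, Def. 2.1 (p. 5)] -/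
theorem exists_kummerOn_ker_of_mem_closure_minus (E : Type) [Field E] [Algebra K E] {ℓ : ℤ} (n : ℕ)
    {ξ : galoisCohomology (GaloisRep.restrictField E (W.torsionGaloisModule ℓ)) 1}
    (hξ : ξ ∈ AddSubgroup.closure {ξ | ∃ x ∈ signedLocalPointsOfEmb κ (closureEmb (K := K) E) W (-1) n ⊓
          (localTraceOfEmb κ (closureEmb (K := K) E) W 0 n).ker,
        ∃ R : localPoints W E, ℓ • R = x ∧
        ∃ φ : contOneCocycles (DiscreteGaloisModule.toTopRep
            (GaloisRep.restrictField E (W.torsionGaloisModule ℓ))),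
          oneCocycleClass _ φ = ξ ∧
          ∀ u ∈ localLayerSubgroupOfEmb κ (closureEmb (K := K) E) n,
            pointsMap W E ((φ.1 u : geomTorsion W ℓ) : geomPoints W) = u • R - R}) :
    ∃ φ : contOneCocycles (DiscreteGaloisModule.toTopRep
        (GaloisRep.restrictField E (W.torsionGaloisModule ℓ))),
      oneCocycleClass _ φ = ξ ∧ ∃ R : localPoints W E, ∀ u ∈ localSubgroup κ.kerSubgroup E,
        pointsMap W E ((φ.1 u : geomTorsion W ℓ) : geomPoints W) = u • R - R := by
  obtain ⟨x, -, R, -, φ, hφ, hφu⟩ := SignedTwist.minus_of_mem_closure W κ E n hξ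
  exact ⟨φ, hφ, R, fun u hu => hφu u (localSubgroup_ker_le_layer κ E n hu)⟩

/-- **The pulled-back minus line satisfies the tower condition.** `E' → E` a `K`-algebra map with
`r : Γ_E → Γ_{E'}` onto and `E/E'` algebraic, `τ` the comparison element, `Θ` a transport with the
cocycle description of file 101. For every `ξ' ∈ H¹(Γ_{E'}, E[ℓ])` with `Θ ξ' ∈ Σ_E` and every layer
`k`: the image of `ξ'` under `H¹(Γ_{E'}, E[ℓ]) → H¹(Γ_{E'}, E(Ē')) → H¹(H_{E',k}, E(Ē'))` lies in the
local tower kernel `𝒦_{E',k}` — file 100's `hCT` for `C = Θ⁻¹(Σ_E)` at `E' = K_{v₀}` (`k = 0`,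
`h𝓣fin`). [cite: GreenbergLNM1716, §3 p. 86] [cite: Kobayashi2003, Def. 2.1 (p. 5)] -/
theorem comp_map_mem_localTowerKer_of_mem_comap (E' E : Type) [Field E'] [Field E] [Algebra K E']
    [Algebra K E] [Algebra E' E] [IsScalarTower K E' E] [Algebra.IsAlgebraic E' E] {ℓ : ℤ} (n k : ℕ)
    {τ : absoluteGaloisGroup K}
    (hτemb : ∀ x : AlgebraicClosure K,
      absClosureEmbedding K E (τ • x) = absClosureEmbedding E' E (absClosureEmbedding K E' x))
    (hτ : ∀ σ : absoluteGaloisGroup E,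
      absGaloisRestrict K E' (absGaloisRestrict E' E σ) = τ⁻¹ * absGaloisRestrict K E σ * τ)
    (hr : Function.Surjective (absGaloisRestrict E' E))
    (Θ : galoisCohomology (GaloisRep.restrictField E' (W.torsionGaloisModule ℓ)) 1 →+
      galoisCohomology (GaloisRep.restrictField E (W.torsionGaloisModule ℓ)) 1)
    (hΘ : ∀ ψ : contOneCocycles (DiscreteGaloisModule.toTopRep
        (GaloisRep.restrictField E' (W.torsionGaloisModule ℓ))),
      ∃ φ : contOneCocycles (DiscreteGaloisModule.toTopRep
        (GaloisRep.restrictField E (W.torsionGaloisModule ℓ))),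
        oneCocycleClass _ φ = Θ (oneCocycleClass _ ψ) ∧
        ∀ σ : absoluteGaloisGroup E, φ.1 σ = (W.torsionGaloisModule ℓ) τ (ψ.1 (absGaloisRestrict E' E σ)))
    {ξ' : galoisCohomology (GaloisRep.restrictField E' (W.torsionGaloisModule ℓ)) 1}
    (hξ' : Θ ξ' ∈ AddSubgroup.closure {ξ | ∃ x ∈ signedLocalPointsOfEmb κ (closureEmb (K := K) E) W (-1) n ⊓
          (localTraceOfEmb κ (closureEmb (K := K) E) W 0 n).ker,
        ∃ R : localPoints W E, ℓ • R = x ∧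
        ∃ φ : contOneCocycles (DiscreteGaloisModule.toTopRep
            (GaloisRep.restrictField E (W.torsionGaloisModule ℓ))),
          oneCocycleClass _ φ = ξ ∧
          ∀ u ∈ localLayerSubgroupOfEmb κ (closureEmb (K := K) E) n,
            pointsMap W E ((φ.1 u : geomTorsion W ℓ) : geomPoints W) = u • R - R}) :
    ((resH1Hom (Literature.NumberTheory.EllipticCurves.subgroupIncl (localSubgroup (κ.layerSubgroup k) E'))
          (AddMonoidHom.id (localPoints W E')) (fun _ _ ↦ rfl)).comp
        (galoisCohomology.map (W.torsionPointsMapIntertwining ℓ E') 1)) ξ' ∈ W.localTowerKer κ E' k := by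
  obtain ⟨ψ, rfl⟩ := oneCocycleClass_surjective _ ξ'
  obtain ⟨φ, hφ, R, hR⟩ := exists_kummerOn_ker_of_mem_closure_minus W κ E n hξ'
  obtain ⟨R', hR'⟩ := kummerOn_ker_of_transport W κ E' E ℓ hτemb hτ hr Θ hΘ ψ φ hφ hR
  exact (comp_map_oneCocycleClass_mem_localTowerKer_iff W κ E' k ℓ ψ).mpr ⟨R', hR'⟩

-- (x1b GEN 42: proof-neutral re-land to re-enqueue the module build — the consumer is file 107,
-- `DefectCountSignedTwistAssembly.lean`; no declaration changed.)

end Summit.BirchSwinnertonDyer.Rank1Residual.Additive.LocalModelTransport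

end
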